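import Summits.BirchSwinnertonDyer.BirchSwinnertonDyer.Theorems.GoodModelKernelH1SubquotientLayer
import HarnessLib

set_option linter.dupNamespace false -- `…BirchSwinnertonDyer.BirchSwinnertonDyer…` is the cell's nested layout (D-0017)
set_option autoImplicit false

/-!
# `H¹(G, Ŵ₀(𝔪̄)) = 0` for a good model from a NORMAL SUBQUOTIENT: vanishing on a normal `N ≤ G` plus the
# relative trace condition above `N` (generalising `Rank1Residual/Additive/GoodModelKernelH1OfDeeplyRamified`)

Cell `pub/bsd-print-x9`, seat `bsd-line-x10b-p1-w2` g13 (KEY (146)/(147) row 10; CG-FRAME road «discharge the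
print leaf G-2.4 = `Greenberg1999.imKummer_eq_strictCondition_goodOrdinary_numberField` ON THE ROUTES' FRAMES»,
pen GO 2026-08-29T00:29:56Z; `--supports` the crux `PrintX10b.BeyondCarrierDepthX10b` whose stub s2c sits behind
that leaf). THEOREMS ONLY (no definition, no named fact, no `sorry`); nothing restated; BSD is not proved by this.

WHAT. The tree derives the Coates–Greenberg record `CoatesGreenberg1996.H1_goodModelKernel_trivial` (`H¹(L, Ŵ₀(𝔪̄)) = 0`
in cocycle form, `L = K̄_v^G`) from the trace form of "deeply ramified" (`KernelH1.exists_eq_smul_sub_of_deeplyRamifiedTrace`);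
that proof uses `κ.IsCyclotomic`, `G ≤ (ker κ)_v` at exactly one point — to get, for an open `O ≤ Γ_{K_v}`, an integral `x`
fixed by `O ∩ G` whose orbit sum over `G/(O ∩ G)` has valuation close to `1`. `exists_eq_smul_sub_of_subquotient` proves
the same conclusion for an ARBITRARY closed `G ≤ Γ_{K_v}` fixing `C`, granted a subgroup `N ≤ G` normal in `Γ_{K_v}` with
(h₁) the record's conclusion AT `N` (every continuous `N`-cocycle with `Φ_C`-values in `Ŵ₀(𝔪̄)` is `n ↦ n • a − a`,
`Φ_C a ∈ Ŵ₀(𝔪̄)`) and (h₂) the RELATIVE trace condition above `N` (for every open normal `O ≤ Γ_{K_v}` CONTAINING `N`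
with `G/(O ∩ G)` finite and every `ρ < 1`, an integral `x` fixed by `O ∩ G` with `ρ < |Σ_{q ∈ G/(O∩G)} q.out • x|`).
With `N = ⊥` this is the deeply-ramified derivation; on the cell's anticyclotomic frames (`G = (ker κ)_v`,
`N = G ∩ (ker κ^cyc)_v`) (h₁) is the kernel theorem `H1_goodModelKernel_trivial_holds` at `N` and (h₂) the unit-trace
element of an UNRAMIFIED finite quotient (`UnramifiedQuotientTraceProofs`, `AnticyclotomicLocalInertiaProofs`).

PROOF. Restrict `φ` to `N`, apply (h₁), subtract the coboundary: `φ' := φ − ∂a` is a continuous cocycle vanishing on `N`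
with `Φ_C`-values in `Ŵ₀(𝔪̄)` and `N`-fixed values (`N ⊴ G`), so the finite normal `M₁ :=` normal closure of
`K_v`(coordinates of the values, entries of `C`) is fixed pointwise by `N` (`N ⊴ Γ_{K_v}`). The zero set of `φ'` contains
`G ∩ Gal(K̄_v/L₀)`, `L₀` finite normal; `O := N ⊔ Gal(K̄_v/(L₀ ⊔ M₁))` is open, normal, `⊇ N`, `= N · Gal(…)` as a set, so
`U := O ∩ G ⊴ G` has finite index, fixes `M₁` and `φ'|_U = 0`; (h₂) at `O` gives `x`; `Kn := M₁ ⊔ K_v(G • x)` is finite,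
`G`-stable, `U`-fixed (sibling `GoodModelKernelH1SubquotientLayer`); then §E–§I of the cyclotomic derivation verbatim
(`Rat`, Hensel lifts, completeness, the engine `AlmostEtale.exists_forall_eq_sub_of_cocycle_of_trace`); `φ = ∂(a + Φ_C⁻¹ P)`.

References: J. Coates, R. Greenberg, Invent. Math. 124 (1996) §3 Thm. 3.1 / Cor. 3.2 [CoatesGreenberg1996]; R. Greenberg,
LNM 1716 (1999) §2 Prop. 2.4, pp. 83–84 [GreenbergLNM1716]; J.-P. Serre, *Galois Cohomology* I §2, §5; tree:
`Rank1Residual/Additive/GoodModelKernelH1*`.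
-/

noncomputable section

open scoped Classical NNReal Pointwise

open WeierstrassCurve NumberField IsDedekindDomain Field Literature.NumberTheory.GaloisRepresentations
  Literature.NumberTheory.EllipticCurves Literature.NumberTheory.EllipticCurves.FormalGroupChart IsDedekindDomain.HeightOneSpectrum
  Summit.BirchSwinnertonDyer.Rank1Residual.Additive.GoodModelLine Summit.BirchSwinnertonDyer.Rank1Residual.Additive.GoodModelLine.KernelH1

universe u

namespace Summit.BirchSwinnertonDyer.BirchSwinnertonDyer.Theorems.GoodModelKernelH1OfSubquotient

variable {K : Type u} [Field K] [NumberField K] {v : HeightOneSpectrum (𝓞 K)}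

/-! ## §3 The derivation from a normal subquotient -/

section Main

open CoatesGreenberg1996

set_option maxHeartbeats 1600000 in
/-- **`H¹(G, Ŵ₀(𝔪̄)) = 0` in cocycle form for a good model `W₀ = C • E ⊗ K̄_v`, from a normal
subquotient.** Binders of the record `CoatesGreenberg1996.H1_goodModelKernel_trivial` (`E/K`
elliptic over a number field, `v`, the spectral valuation `w` (`hw`), a good model (`C`, `W₀`,
`hW₀`, `hΔ`), a CLOSED `G ≤ Γ_{K_v}` whose elements fix `C` (`hGc`, `hGC`)) with the pair
(`κ` cyclotomic, `G ≤ (ker κ)_v`) REPLACED by: a subgroup `N ≤ G` (`hNG`) normal in `Γ_{K_v}`;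
(h₁) every continuous crossed homomorphism `N → E(K̄_v)` with `Φ_C`-values in `Ŵ₀(𝔪̄)` is
`n ↦ n • a − a` with `Φ_C(a) ∈ Ŵ₀(𝔪̄)` (the record's conclusion AT `N`); (h₂) for every open
normal `O ≤ Γ_{K_v}` containing `N` with `G/(O ∩ G)` finite and every `ρ < 1`, an integral
`x ∈ K̄_v` fixed by `O ∩ G` with `ρ < |Σ_{q ∈ G/(O ∩ G)} q.out • x|` (the trace form of "deeply
ramified" RELATIVE to `N`). CONCLUSION (the record's, at `G`): every continuous crossed homomorphism
`φ : G → E(K̄_v)` with `Φ_C(φ g) ∈ Ŵ₀(𝔪̄)` is `g ↦ g • a − a` with `Φ_C(a) ∈ Ŵ₀(𝔪̄)`. Proof: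
module docstring ([CoGr] Thm. 3.1's successive approximation,
`AlmostEtale.exists_forall_eq_sub_of_cocycle_of_trace`, after restriction to `N` and subtraction
of the coboundary). With `N = ⊥` this is `KernelH1.exists_eq_smul_sub_of_deeplyRamifiedTrace`.
[cite: CoatesGreenberg1996, §3 Thm. 3.1 (mechanism) and Cor. 3.2, through GreenbergLNM1716 pp. 36–37, 83–84] -/
theorem exists_eq_smul_sub_of_subquotient
    (W : WeierstrassCurve K) [W.IsElliptic]
    (w : Valuation (AlgebraicClosure (v.adicCompletion K)) ℝ≥0)
    (hw : ∀ x, (w x : ℝ) = spectralNorm (v.adicCompletion K) (AlgebraicClosure (v.adicCompletion K)) x)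
    (C : VariableChange (AlgebraicClosure (v.adicCompletion K)))
    (W₀ : WeierstrassCurve w.integer)
    (hW₀ : C • (W.baseChange (v.adicCompletion K)).baseChange (AlgebraicClosure (v.adicCompletion K)) = W₀.baseChange (AlgebraicClosure (v.adicCompletion K)))
    (hΔ : IsUnit W₀.Δ)
    (G : Subgroup (absoluteGaloisGroup (v.adicCompletion K)))
    (hGc : IsClosed (G : Set (absoluteGaloisGroup (v.adicCompletion K))))
    (hGC : ∀ σ ∈ G, C.map ((absoluteGaloisGroup.toAlgEquiv (v.adicCompletion K) σ : AlgebraicClosure (v.adicCompletion K) ≃ₐ[v.adicCompletion K] AlgebraicClosure (v.adicCompletion K)) : AlgebraicClosure (v.adicCompletion K) →+* AlgebraicClosure (v.adicCompletion K)) = C)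
    (N : Subgroup (absoluteGaloisGroup (v.adicCompletion K))) [hNn : N.Normal] (hNG : N ≤ G)
    (h₁ : ∀ ψ : contOneCocycles (discreteTopRep N (localPoints W (v.adicCompletion K))), (∀ n, Affine.Point.congrEquiv hW₀ (VariableChange.pointEquiv _ C (Affine.Point.congrEquiv (baseChange_baseChange_adicCompletion W v).symm (ψ.1 n))) ∈ kernelOfReduction W₀ (Valuation.integer.integers w)) →
      ∃ a : localPoints W (v.adicCompletion K), Affine.Point.congrEquiv hW₀ (VariableChange.pointEquiv _ C (Affine.Point.congrEquiv (baseChange_baseChange_adicCompletion W v).symm a)) ∈ kernelOfReduction W₀ (Valuation.integer.integers w) ∧ ∀ n : N, ψ.1 n = n • a - a)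
    (h₂ : ∀ (O : Subgroup (absoluteGaloisGroup (v.adicCompletion K))), O.Normal → IsOpen (O : Set (absoluteGaloisGroup (v.adicCompletion K))) → N ≤ O → ∀ [Fintype (G ⧸ O.subgroupOf G)] (ρ : ℝ≥0), ρ < 1 → ∃ x : AlgebraicClosure (v.adicCompletion K), w x ≤ 1 ∧ (∀ u ∈ O ⊓ G, u • x = x) ∧
        ρ < w (∑ q : G ⧸ O.subgroupOf G, ((q.out : G) : absoluteGaloisGroup (v.adicCompletion K)) • x))
    (φ : contOneCocycles (discreteTopRep G (localPoints W (v.adicCompletion K))))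
    (hφ : ∀ g, Affine.Point.congrEquiv hW₀ (VariableChange.pointEquiv _ C (Affine.Point.congrEquiv (baseChange_baseChange_adicCompletion W v).symm (φ.1 g))) ∈ kernelOfReduction W₀ (Valuation.integer.integers w)) :
    ∃ a : localPoints W (v.adicCompletion K), Affine.Point.congrEquiv hW₀ (VariableChange.pointEquiv _ C (Affine.Point.congrEquiv (baseChange_baseChange_adicCompletion W v).symm a)) ∈ kernelOfReduction W₀ (Valuation.integer.integers w) ∧ ∀ g : G, φ.1 g = g • a - a := by
  -- §A notation and basic structure
  haveI hGal := isGalois_algebraicClosure_adicCompletion (v := v)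
  haveI : CharZero (v.adicCompletion K) := charZero_of_injective_algebraMap (algebraMap K (v.adicCompletion K)).injective
  haveI hVint : (W₀.baseChange (AlgebraicClosure (v.adicCompletion K))).IsIntegral w.integer := ⟨⟨W₀, rfl⟩⟩
  haveI hVell : (W₀.baseChange (AlgebraicClosure (v.adicCompletion K))).IsElliptic := by rw [isElliptic_iff, baseChange, map_Δ]; exact hΔ.map _
  have hvw : w.Integers w.integer := Valuation.integer.integers w
  set Φ : localPoints W (v.adicCompletion K) ≃+ (W₀.baseChange (AlgebraicClosure (v.adicCompletion K))).toAffine.Point := ((Affine.Point.congrEquiv (baseChange_baseChange_adicCompletion W v).symm).trans (VariableChange.pointEquiv _ C)).trans (Affine.Point.congrEquiv hW₀) with hΦdef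
  have hΦ : ∀ P, Φ P = Affine.Point.congrEquiv hW₀ (VariableChange.pointEquiv _ C (Affine.Point.congrEquiv (baseChange_baseChange_adicCompletion W v).symm P)) := fun _ ↦ rfl
  set T : (absoluteGaloisGroup (v.adicCompletion K)) → (W₀.baseChange (AlgebraicClosure (v.adicCompletion K))).toAffine.Point →+ (W₀.baseChange (AlgebraicClosure (v.adicCompletion K))).toAffine.Point := fun g ↦ Φ.toAddMonoidHom.comp
      ((DistribSMul.toAddMonoidHom (localPoints W (v.adicCompletion K)) g).comp Φ.symm.toAddMonoidHom) with hTdef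
  have hT : ∀ g P, T g P = Φ (g • Φ.symm P) := fun _ _ ↦ rfl
  set σ : (absoluteGaloisGroup (v.adicCompletion K)) → ((AlgebraicClosure (v.adicCompletion K)) ≃+* (AlgebraicClosure (v.adicCompletion K))) := fun g ↦ ((absoluteGaloisGroup.toAlgEquiv (v.adicCompletion K) g : (AlgebraicClosure (v.adicCompletion K)) ≃ₐ[(v.adicCompletion K)]
        (AlgebraicClosure (v.adicCompletion K))).toRingEquiv) with hσdef
  have hσ : ∀ g z, σ g z = g • z := fun _ _ ↦ rfl
  have hσw : ∀ g z, w (σ g z) = w z := fun g z ↦ spectralValuation_smul hw g z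
  have hTsome : ∀ g : (absoluteGaloisGroup (v.adicCompletion K)), C.map ((absoluteGaloisGroup.toAlgEquiv (v.adicCompletion K) g : (AlgebraicClosure (v.adicCompletion K)) ≃ₐ[(v.adicCompletion K)] (AlgebraicClosure (v.adicCompletion K))) :
        (AlgebraicClosure (v.adicCompletion K)) →+* (AlgebraicClosure (v.adicCompletion K))) = C → ∀ {x y : (AlgebraicClosure (v.adicCompletion K))}
        {h : (W₀.baseChange (AlgebraicClosure (v.adicCompletion K))).toAffine.Nonsingular x y}, ∃ h', T g (.some x y h) = .some (σ g x) (σ g y) h' := by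
    intro g hgC x y h
    have hP : Affine.Point.congrEquiv hW₀ (VariableChange.pointEquiv _ C (Affine.Point.congrEquiv (baseChange_baseChange_adicCompletion W v).symm (Φ.symm (.some x y h)))) = .some x y h := by
      rw [← hΦ, AddEquiv.apply_symm_apply]
    obtain ⟨h', e⟩ := transport_smul_of_eq_some W v C hW₀ g hgC (Φ.symm (.some x y h)) hP
    exact ⟨h', by rw [hT, hΦ, e]; rfl⟩
  have hTC_ker : ∀ g, C.map ((absoluteGaloisGroup.toAlgEquiv (v.adicCompletion K) g : (AlgebraicClosure (v.adicCompletion K)) ≃ₐ[(v.adicCompletion K)] (AlgebraicClosure (v.adicCompletion K))) : (AlgebraicClosure (v.adicCompletion K)) →+* (AlgebraicClosure (v.adicCompletion K))) = C →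
      ∀ P, P ∈ kernel w (W₀.baseChange (AlgebraicClosure (v.adicCompletion K))) → T g P ∈ kernel w (W₀.baseChange (AlgebraicClosure (v.adicCompletion K))) ∧ (T g P).zCoord = σ g P.zCoord := by
    intro g hgC P hPK
    rcases P with _ | ⟨x, y, h⟩
    · rw [← WeierstrassCurve.Affine.Point.zero_def, map_zero, WeierstrassCurve.Affine.Point.zCoord_zero, map_zero]
      exact ⟨(kernel w _).zero_mem, rfl⟩
    · obtain ⟨h', e⟩ := hTsome g hgC (x := x) (y := y) (h := h)
      rw [e, WeierstrassCurve.Affine.Point.zCoord_some, WeierstrassCurve.Affine.Point.zCoord_some, some_mem_kernel_iff, hσw, map_div₀, map_neg]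
      exact ⟨(some_mem_kernel_iff h).mp hPK, rfl⟩
  have hGC' : ∀ g : G, C.map ((absoluteGaloisGroup.toAlgEquiv (v.adicCompletion K) (g : (absoluteGaloisGroup (v.adicCompletion K))) : (AlgebraicClosure (v.adicCompletion K)) ≃ₐ[(v.adicCompletion K)] (AlgebraicClosure (v.adicCompletion K))) :
        (AlgebraicClosure (v.adicCompletion K)) →+* (AlgebraicClosure (v.adicCompletion K))) = C := fun g ↦ hGC g g.2
  have hTmul : ∀ g h P, T (g * h) P = T g (T h P) := fun g h P ↦ by rw [hT, hT, hT, AddEquiv.symm_apply_apply, mul_smul]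
  have hker : ∀ P : localPoints W (v.adicCompletion K), Φ P ∈ kernel w (W₀.baseChange (AlgebraicClosure (v.adicCompletion K))) ↔ Affine.Point.congrEquiv hW₀ (VariableChange.pointEquiv _ C (Affine.Point.congrEquiv (baseChange_baseChange_adicCompletion W v).symm P)) ∈
          kernelOfReduction W₀ (Valuation.integer.integers w) := fun P ↦ by rw [mem_kernel_iff_reducesToZero W₀, ← mem_kernelOfReduction_iff hvw, hΦ]
  -- §B descent along `N`: restriction, (h₁), subtraction of the coboundary
  obtain ⟨ψ, hψ⟩ := exists_contOneCocycles_restrict W hNG φ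
  obtain ⟨a, haK, hψa⟩ := h₁ ψ (fun n ↦ by rw [hψ]; exact hφ _)
  have haK' : Φ a ∈ kernel w (W₀.baseChange (AlgebraicClosure (v.adicCompletion K))) := (hker a).2 haK
  obtain ⟨δ, hδ⟩ := exists_contOneCocycles_coboundary W G a
  set φ' : contOneCocycles (discreteTopRep G (localPoints W (v.adicCompletion K))) := φ - δ with hφ'def
  have hφ'_apply : ∀ g : G, φ'.1 g = φ.1 g - ((g : absoluteGaloisGroup (v.adicCompletion K)) • a - a) := fun g ↦ by rw [← hδ g]; rfl
  have hφ'N : ∀ n : G, (n : absoluteGaloisGroup (v.adicCompletion K)) ∈ N → φ'.1 n = 0 := by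
    intro n hn
    have h1 : φ.1 n = ψ.1 ⟨(n : absoluteGaloisGroup (v.adicCompletion K)), hn⟩ := by rw [hψ]; rfl
    rw [hφ'_apply, h1, hψa, sub_eq_zero]; rfl
  have hφ'Nfix : ∀ n : G, (n : absoluteGaloisGroup (v.adicCompletion K)) ∈ N → ∀ g : G, (n : absoluteGaloisGroup (v.adicCompletion K)) • φ'.1 g = φ'.1 g := by
    intro n hn g
    have e1 : φ'.1 (n * g) = (n : absoluteGaloisGroup (v.adicCompletion K)) • φ'.1 g := by rw [φ'.2 n g, hφ'N n hn, zero_add, discreteTopRep_ρ_apply]; rfl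
    have hm : ((g⁻¹ * n * g : G) : absoluteGaloisGroup (v.adicCompletion K)) ∈ N := by rw [Subgroup.coe_mul, Subgroup.coe_mul, Subgroup.coe_inv]; exact hNn.conj_mem' _ hn _
    have e2 : φ'.1 (n * g) = φ'.1 g := by
      rw [show n * g = g * (g⁻¹ * n * g) by group, φ'.2, hφ'N _ hm, map_zero, add_zero]
    rw [← e1, e2]
  set c : G → (W₀.baseChange (AlgebraicClosure (v.adicCompletion K))).toAffine.Point := fun g ↦ Φ (φ'.1 g) with hcdef
  have hc_apply : ∀ g, c g = Φ (φ'.1 g) := fun _ ↦ rfl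
  have hcK : ∀ g, c g ∈ kernel w (W₀.baseChange (AlgebraicClosure (v.adicCompletion K))) := by
    intro g
    have hga : Φ ((g : absoluteGaloisGroup (v.adicCompletion K)) • a) = T (g : absoluteGaloisGroup (v.adicCompletion K)) (Φ a) := by rw [hT, AddEquiv.symm_apply_apply]
    have hφg : Φ (φ.1 g) ∈ kernel w (W₀.baseChange (AlgebraicClosure (v.adicCompletion K))) := (hker _).2 (hφ g)
    have hTa : T (g : absoluteGaloisGroup (v.adicCompletion K)) (Φ a) ∈ kernel w (W₀.baseChange (AlgebraicClosure (v.adicCompletion K))) := (hTC_ker _ (hGC' g) _ haK').1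
    have hd : T (g : absoluteGaloisGroup (v.adicCompletion K)) (Φ a) - Φ a ∈ kernel w (W₀.baseChange (AlgebraicClosure (v.adicCompletion K))) := AddSubgroup.sub_mem (kernel w _) (x := T (g : absoluteGaloisGroup (v.adicCompletion K)) (Φ a))
        (y := Φ a) hTa haK'
    have hres : Φ (φ.1 g) - (T (g : absoluteGaloisGroup (v.adicCompletion K)) (Φ a) - Φ a) ∈ kernel w (W₀.baseChange (AlgebraicClosure (v.adicCompletion K))) := AddSubgroup.sub_mem (kernel w (W₀.baseChange (AlgebraicClosure (v.adicCompletion K))))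
        (x := Φ (φ.1 g)) (y := T (g : absoluteGaloisGroup (v.adicCompletion K)) (Φ a) - Φ a) hφg hd
    rw [hc_apply, hφ'_apply, map_sub, map_sub, hga]; exact @hres
  have hcoc : ∀ g h : G, c (g * h) = c g + T (g : (absoluteGaloisGroup (v.adicCompletion K))) (c h) := by
    intro g h; rw [hc_apply, hc_apply, hc_apply, hT, AddEquiv.symm_apply_apply, φ'.2 g h, map_add, discreteTopRep_ρ_apply]; rfl
  have hcN : ∀ n : G, (n : absoluteGaloisGroup (v.adicCompletion K)) ∈ N → c n = 0 := fun n hn ↦ by rw [hc_apply, hφ'N n hn, map_zero]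
  have hcNfix : ∀ n : G, (n : absoluteGaloisGroup (v.adicCompletion K)) ∈ N → ∀ g : G, T (n : absoluteGaloisGroup (v.adicCompletion K)) (c g) = c g := fun n hn g ↦ by rw [hc_apply, hT, AddEquiv.symm_apply_apply, hφ'Nfix n hn g]
  -- §C the open zero set of `φ'` and the finite normal `L₀`
  obtain ⟨L₀, hL₀fin, hL₀normal, hL₀sub⟩ := exists_normal_fixingSubgroup_subset G
    ((isOpen_discrete ({0} : Set (localPoints W (v.adicCompletion K)))).preimage φ'.1.continuous)
    (show (1 : G) ∈ φ'.1 ⁻¹' {0} from contOneCocycles.apply_one φ')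
  haveI := hL₀fin; haveI := hL₀normal
  -- the finite set of coordinates: values of `c`, entries of `C` — all fixed by `N`
  haveI : CompactSpace G := isCompact_iff_compactSpace.mp hGc.isCompact
  have hfin_range : (Set.range φ'.1).Finite := (isCompact_range φ'.1.continuous).finite_of_discrete
  set S₀ : Set (AlgebraicClosure (v.adicCompletion K)) := {z | ∃ P ∈ Set.range c, ∃ x y, ∃ h : (W₀.baseChange (AlgebraicClosure (v.adicCompletion K))).toAffine.Nonsingular x y, P = .some x y h ∧ (z = x ∨ z = y)} ∪
      ({(C.u : (AlgebraicClosure (v.adicCompletion K))), C.r, C.s, C.t} : Set (AlgebraicClosure (v.adicCompletion K))) with hS₀def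
  have hfin_c : (Set.range c).Finite := Set.Finite.subset (hfin_range.image Φ) (by rintro _ ⟨g, rfl⟩; exact ⟨φ'.1 g, ⟨g, rfl⟩, rfl⟩)
  have hS₀fin : S₀.Finite := Set.Finite.union (finite_coords hfin_c) (Set.toFinite _)
  haveI : Finite S₀ := hS₀fin.to_subtype
  haveI hS₀fd : FiniteDimensional (v.adicCompletion K)
      (IntermediateField.adjoin (v.adicCompletion K) S₀) := IntermediateField.finiteDimensional_adjoin fun z _ ↦ (Algebra.IsAlgebraic.isAlgebraic (R := (v.adicCompletion K)) z).isIntegral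
  set M₁ : IntermediateField (v.adicCompletion K) (AlgebraicClosure (v.adicCompletion K)) := IntermediateField.normalClosure (v.adicCompletion K)
      (IntermediateField.adjoin (v.adicCompletion K) S₀) (AlgebraicClosure (v.adicCompletion K)) with hM₁def
  haveI hM₁fd : FiniteDimensional (v.adicCompletion K) M₁ := by rw [hM₁def]; infer_instance
  haveI hM₁n : Normal (v.adicCompletion K) M₁ := by rw [hM₁def]; infer_instance
  have hS₀M₁ : S₀ ⊆ (M₁ : Set (AlgebraicClosure (v.adicCompletion K))) := (IntermediateField.subset_adjoin (v.adicCompletion K) S₀).trans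
      (by rw [hM₁def]; exact IntermediateField.le_normalClosure _)
  -- `N` fixes `S₀` pointwise
  have hNS₀ : ∀ n ∈ N, ∀ z ∈ S₀, n • z = z := by
    intro n hn z hz
    have hnC := hGC n (hNG hn)
    rcases hz with ⟨P, ⟨g, rfl⟩, X, Y, h, hP, hz⟩ | hz
    · have hfix := hcNfix ⟨n, hNG hn⟩ hn g
      obtain ⟨h', e⟩ := hTsome n hnC (x := X) (y := Y) (h := h)
      rw [hP, e] at hfix
      simp only [WeierstrassCurve.Affine.Point.some.injEq] at hfix
      rcases hz with rfl | rfl <;> [exact hfix.1; exact hfix.2]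
    · have hu : n • (C.u : AlgebraicClosure (v.adicCompletion K)) = C.u := congrArg (fun D : VariableChange (AlgebraicClosure (v.adicCompletion K)) ↦ (D.u : AlgebraicClosure (v.adicCompletion K))) hnC
      have hr : n • C.r = C.r := congrArg (fun D : VariableChange (AlgebraicClosure (v.adicCompletion K)) ↦ D.r) hnC
      have hs : n • C.s = C.s := congrArg (fun D : VariableChange (AlgebraicClosure (v.adicCompletion K)) ↦ D.s) hnC
      have ht : n • C.t = C.t := congrArg (fun D : VariableChange (AlgebraicClosure (v.adicCompletion K)) ↦ D.t) hnC
      simp only [Set.mem_insert_iff, Set.mem_singleton_iff] at hz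
      rcases hz with rfl | rfl | rfl | rfl <;> [exact hu; exact hr; exact hs; exact ht]
  -- `N` fixes `M₁` pointwise (`N ⊴ Γ_{K_v}`, `GoodModelKernelH1SubquotientLayer` §3)
  have hNM₁ : ∀ n ∈ N, ∀ z ∈ M₁, n • z = z := fun n hn z hz ↦ smul_eq_self_of_mem_normalClosure_adjoin N S₀ hNS₀ hn (by rw [hM₁def] at hz; exact hz)
  -- the finite normal `M₂ = L₀ ⊔ M₁`, `O₁ = Gal(K̄_v/M₂)`, `O = N ⊔ O₁`, `U = O ∩ G`
  set M₂ : IntermediateField (v.adicCompletion K) (AlgebraicClosure (v.adicCompletion K)) := L₀ ⊔ M₁ with hM₂def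
  haveI hM₂fd : FiniteDimensional (v.adicCompletion K) M₂ := IntermediateField.finiteDimensional_sup _ _
  haveI hM₂n : Normal (v.adicCompletion K) M₂ := by rw [hM₂def]; infer_instance
  have hL₀M₂ : L₀ ≤ M₂ := le_sup_left; have hM₁M₂ : M₁ ≤ M₂ := le_sup_right
  set O₁ : Subgroup (absoluteGaloisGroup (v.adicCompletion K)) := M₂.fixingSubgroup.comap (absoluteGaloisGroup.toAlgEquiv (v.adicCompletion K)).toMonoidHom with hO₁def
  have hO₁_mem : ∀ τ, τ ∈ O₁ ↔ absoluteGaloisGroup.toAlgEquiv (v.adicCompletion K) τ ∈ M₂.fixingSubgroup := fun _ ↦ Subgroup.mem_comap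
  haveI hO₁n : O₁.Normal := fixingSubgroup_comap_normal M₂
  have hO₁open : IsOpen (O₁ : Set (absoluteGaloisGroup (v.adicCompletion K))) := M₂.fixingSubgroup_isOpen
  set O : Subgroup (absoluteGaloisGroup (v.adicCompletion K)) := N ⊔ O₁ with hOdef
  haveI hOn : O.Normal := Subgroup.sup_normal N O₁
  have hOopen : IsOpen (O : Set (absoluteGaloisGroup (v.adicCompletion K))) := Subgroup.isOpen_mono (le_sup_right : O₁ ≤ O) hO₁open
  have hNO : N ≤ O := le_sup_left
  set U : Subgroup G := O.subgroupOf G with hUdef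
  have hU_mem : ∀ u : G, u ∈ U ↔ (u : absoluteGaloisGroup (v.adicCompletion K)) ∈ O := fun _ ↦ Subgroup.mem_subgroupOf
  haveI hUn : U.Normal := by rw [hUdef]; infer_instance
  haveI : Finite (G ⧸ O₁.subgroupOf G) := finite_quotient_subgroupOf_fixingSubgroup M₂ G
  haveI : Finite (G ⧸ U) := finite_quotient_of_le (show O₁.subgroupOf G ≤ U from Subgroup.comap_mono (le_sup_right : O₁ ≤ O))
  letI : Fintype (G ⧸ U) := Fintype.ofFinite _
  have hU_decomp : ∀ u : G, u ∈ U → ∃ n : G, (n : absoluteGaloisGroup (v.adicCompletion K)) ∈ N ∧ ∃ o : G, (o : absoluteGaloisGroup (v.adicCompletion K)) ∈ O₁ ∧ u = n * o := by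
    intro u hu
    have hu' : (u : absoluteGaloisGroup (v.adicCompletion K)) ∈ ((N : Set (absoluteGaloisGroup (v.adicCompletion K))) * (O₁ : Set (absoluteGaloisGroup (v.adicCompletion K)))) := by
      rw [← Subgroup.normal_mul]; exact (hU_mem u).1 hu
    obtain ⟨n, hn, o, ho, hno⟩ := Set.mem_mul.mp hu'
    have hnG : n ∈ G := hNG hn
    have hoG : o ∈ G := by rw [show o = n⁻¹ * u by rw [← hno, inv_mul_cancel_left]]; exact G.mul_mem (G.inv_mem hnG) u.2
    exact ⟨⟨n, hnG⟩, hn, ⟨o, hoG⟩, ho, Subtype.ext hno.symm⟩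
  have hφ'U : ∀ u : G, u ∈ U → φ'.1 u = 0 := by
    intro u hu
    obtain ⟨n, hn, o, ho, rfl⟩ := hU_decomp u hu
    have ho0 : φ'.1 o = 0 := hL₀sub o (IntermediateField.fixingSubgroup_le hL₀M₂ ((hO₁_mem _).1 ho))
    rw [φ'.2 n o, hφ'N n hn, ho0, map_zero, add_zero]
  have hcU : ∀ u ∈ U, c u = 0 := fun u hu ↦ by rw [hc_apply, hφ'U u hu, map_zero]
  have hUM₁ : ∀ u : G, u ∈ U → absoluteGaloisGroup.toAlgEquiv (v.adicCompletion K)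
      (u : absoluteGaloisGroup (v.adicCompletion K)) ∈ M₁.fixingSubgroup := by
    intro u hu
    obtain ⟨n, hn, o, ho, rfl⟩ := hU_decomp u hu
    rw [IntermediateField.mem_fixingSubgroup_iff]; intro z hz
    have ho' : absoluteGaloisGroup.toAlgEquiv (v.adicCompletion K) (o : absoluteGaloisGroup (v.adicCompletion K)) z = z := by
      have h := (hO₁_mem _).1 ho; rw [IntermediateField.mem_fixingSubgroup_iff] at h; exact h z (hM₁M₂ hz)
    rw [Subgroup.coe_mul, map_mul, AlgEquiv.mul_apply, ho']
    exact hNM₁ _ hn z hz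
  -- §D the bound `ρ₀` and the relative trace condition (h₂)
  set ρ₀ : ℝ≥0 := hfin_range.toFinset.sup fun P ↦ w (Φ P).zCoord with hρ₀def
  have hρ₀lt : ρ₀ < 1 := by
    rw [hρ₀def, Finset.sup_lt_iff (bot_lt_iff_ne_bot.mpr one_ne_zero)]; intro P hP
    obtain ⟨g, rfl⟩ := hfin_range.mem_toFinset.mp hP; exact val_zCoord_lt_one (hcK g)
  have hcρ₀ : ∀ g, w (c g).zCoord ≤ ρ₀ := fun g ↦ Finset.le_sup (f := fun P ↦ w (Φ P).zCoord) (hfin_range.mem_toFinset.mpr ⟨g, rfl⟩)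
  have hsqrt : NNReal.sqrt ρ₀ < 1 := by rw [← NNReal.sqrt_one]; exact NNReal.sqrt_lt_sqrt.mpr hρ₀lt
  obtain ⟨x, hx1, hxU, hxtr⟩ := h₂ O hOn hOopen hNO (NNReal.sqrt ρ₀) hsqrt
  have hxU' : ∀ u : G, u ∈ U → (u : absoluteGaloisGroup (v.adicCompletion K)) • x = x := fun u hu ↦ hxU u ⟨(hU_mem u).1 hu, u.2⟩
  have hsum_eq : (∑ q : G ⧸ U, σ ((q.out : G) : (absoluteGaloisGroup (v.adicCompletion K))) x) = ∑ q : G ⧸ O.subgroupOf G, ((q.out : G) : (absoluteGaloisGroup (v.adicCompletion K))) • x := rfl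
  have hηpos : 0 < w (∑ q : G ⧸ U, σ ((q.out : G) : (absoluteGaloisGroup (v.adicCompletion K))) x) := lt_of_le_of_lt zero_le (hsum_eq ▸ hxtr)
  have hη2 : ρ₀ < w (∑ q : G ⧸ U, σ ((q.out : G) : (absoluteGaloisGroup (v.adicCompletion K))) x) ^ 2 := by
    rw [hsum_eq]
    exact NNReal.sqrt_lt_sqrt.mp (by rw [NNReal.sqrt_sq]; exact hxtr : NNReal.sqrt ρ₀ < NNReal.sqrt (w (∑ q : G ⧸ O.subgroupOf G, ((q.out : G) : (absoluteGaloisGroup (v.adicCompletion K))) • x) ^ 2))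
  -- §E the finite `G`-stable layer `Kn ∋ x` fixed by `U`
  set orb : Set (AlgebraicClosure (v.adicCompletion K)) := Set.range fun q : G ⧸ U ↦ ((q.out : G) : (absoluteGaloisGroup (v.adicCompletion K))) • x with horbdef
  haveI : Finite orb := Set.finite_range _ |>.to_subtype
  haveI : FiniteDimensional (v.adicCompletion K)
      (IntermediateField.adjoin (v.adicCompletion K) orb) := IntermediateField.finiteDimensional_adjoin fun z _ ↦ (Algebra.IsAlgebraic.isAlgebraic (R := (v.adicCompletion K)) z).isIntegral
  set Kn : IntermediateField (v.adicCompletion K) (AlgebraicClosure (v.adicCompletion K)) := M₁ ⊔ IntermediateField.adjoin (v.adicCompletion K) orb with hKndef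
  haveI hKnfd : FiniteDimensional (v.adicCompletion K) Kn := IntermediateField.finiteDimensional_sup _ _
  have hM₁Kn : M₁ ≤ Kn := le_sup_left
  have hxorb : x ∈ orb := by
    have h := smul_mem_range_out_smul G U x hxU' (1 : G); rw [Subgroup.coe_one, one_smul] at h; exact h
  have hxKn : x ∈ Kn := (le_sup_right : _ ≤ Kn) (IntermediateField.subset_adjoin _ _ hxorb)
  have hKnG : ∀ g : G, ∀ z ∈ Kn, (g : (absoluteGaloisGroup (v.adicCompletion K))) • z ∈ Kn := fun g z hz ↦ smul_mem_orbitLayer M₁ G U x hxU' g hz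
  have hUKn : ∀ u : G, u ∈ U → ∀ z ∈ Kn, (u : (absoluteGaloisGroup (v.adicCompletion K))) • z = z := fun u hu z hz ↦ smul_eq_self_of_mem_orbitLayer M₁ G U x hxU' hu (hUM₁ u hu) hz
  have hKnC : ∀ τ : (absoluteGaloisGroup (v.adicCompletion K)), absoluteGaloisGroup.toAlgEquiv (v.adicCompletion K) τ ∈ Kn.fixingSubgroup → C.map ((absoluteGaloisGroup.toAlgEquiv (v.adicCompletion K) τ : (AlgebraicClosure (v.adicCompletion K)) ≃ₐ[(v.adicCompletion K)]
          (AlgebraicClosure (v.adicCompletion K))) : (AlgebraicClosure (v.adicCompletion K)) →+* (AlgebraicClosure (v.adicCompletion K))) = C := by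
    intro τ hτ; rw [IntermediateField.mem_fixingSubgroup_iff] at hτ
    have hfix : ∀ z ∈ S₀, (absoluteGaloisGroup.toAlgEquiv (v.adicCompletion K) τ) z = z := fun z hz ↦ hτ z (hM₁Kn (hS₀M₁ hz))
    have hu : (absoluteGaloisGroup.toAlgEquiv (v.adicCompletion K) τ)
        (C.u : (AlgebraicClosure (v.adicCompletion K))) = C.u := hfix _ (Or.inr (by simp))
    have hr : (absoluteGaloisGroup.toAlgEquiv (v.adicCompletion K) τ) C.r = C.r := hfix _ (Or.inr (by simp))
    have hs : (absoluteGaloisGroup.toAlgEquiv (v.adicCompletion K) τ) C.s = C.s := hfix _ (Or.inr (by simp))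
    have ht' : (absoluteGaloisGroup.toAlgEquiv (v.adicCompletion K) τ) C.t = C.t := hfix _ (Or.inr (by simp))
    exact variableChange_map_eq_of_apply_eq C _ hu hr hs ht'
  -- §F the subgroup `Rat` of points fixed by `Gal(K̄_v/Kn)` and its description by coordinates
  set Rat : AddSubgroup (W₀.baseChange (AlgebraicClosure (v.adicCompletion K))).toAffine.Point :=
    { carrier := {P | ∀ τ : (absoluteGaloisGroup (v.adicCompletion K)),
        absoluteGaloisGroup.toAlgEquiv (v.adicCompletion K) τ ∈ Kn.fixingSubgroup → T τ P = P}
      add_mem' := fun {P Q} hP hQ τ hτ ↦ by rw [map_add, hP τ hτ, hQ τ hτ]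
      zero_mem' := fun τ _ ↦ map_zero _
      neg_mem' := fun {P} hP τ hτ ↦ by rw [map_neg, hP τ hτ] } with hRatdef
  have hRat_mem : ∀ P, P ∈ Rat ↔ ∀ τ : (absoluteGaloisGroup (v.adicCompletion K)), absoluteGaloisGroup.toAlgEquiv (v.adicCompletion K) τ ∈ Kn.fixingSubgroup → T τ P = P := fun _ ↦ Iff.rfl
  have hKn_mem : ∀ z : (AlgebraicClosure (v.adicCompletion K)), z ∈ Kn ↔ ∀ τ : (absoluteGaloisGroup (v.adicCompletion K)), absoluteGaloisGroup.toAlgEquiv (v.adicCompletion K) τ ∈ Kn.fixingSubgroup → σ τ z = z := fun z ↦ mem_iff_forall_smul_eq Kn z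
  have hRat_coords : ∀ {X Y : (AlgebraicClosure (v.adicCompletion K))}
      {h : (W₀.baseChange (AlgebraicClosure (v.adicCompletion K))).toAffine.Nonsingular X Y}, (.some X Y h) ∈ Rat ↔ X ∈ Kn ∧ Y ∈ Kn := by
    intro X Y h; rw [hRat_mem, hKn_mem, hKn_mem]; constructor
    · intro hP
      refine ⟨fun τ hτ ↦ ?_, fun τ hτ ↦ ?_⟩ <;>
      · obtain ⟨h', e⟩ := hTsome τ (hKnC τ hτ) (x := X) (y := Y) (h := h)
        have := (e.symm.trans (hP τ hτ))
        simp only [WeierstrassCurve.Affine.Point.some.injEq] at this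
        first | exact this.1 | exact this.2
    · rintro ⟨hX, hY⟩ τ hτ
      obtain ⟨h', e⟩ := hTsome τ (hKnC τ hτ) (x := X) (y := Y) (h := h)
      rw [e]; exact point_some_eq_some (hX τ hτ) (hY τ hτ)
  have hRatU' : ∀ u : G, u ∈ U → absoluteGaloisGroup.toAlgEquiv (v.adicCompletion K)
      (u : (absoluteGaloisGroup (v.adicCompletion K))) ∈ Kn.fixingSubgroup :=
    fun u hu ↦ by rw [IntermediateField.mem_fixingSubgroup_iff]; exact hUKn u hu
  have hRatT : ∀ g : G, ∀ P ∈ Rat, T (g : (absoluteGaloisGroup (v.adicCompletion K))) P ∈ Rat := by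
    intro g P hP; rcases P with _ | ⟨X, Y, h⟩
    · rw [← WeierstrassCurve.Affine.Point.zero_def, map_zero]; exact Rat.zero_mem
    · obtain ⟨hX, hY⟩ := hRat_coords.mp hP
      obtain ⟨h', e⟩ := hTsome _ (hGC' g) (x := X) (y := Y) (h := h)
      rw [e, hRat_coords, hσ, hσ]; exact ⟨hKnG g X hX, hKnG g Y hY⟩
  have hRatz : ∀ P ∈ Rat, P ∈ kernel w (W₀.baseChange (AlgebraicClosure (v.adicCompletion K))) → P.zCoord ∈ Kn.toSubfield := by
    intro P hP _; rcases P with _ | ⟨X, Y, h⟩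
    · rw [← WeierstrassCurve.Affine.Point.zero_def, WeierstrassCurve.Affine.Point.zCoord_zero]; exact Kn.toSubfield.zero_mem
    · obtain ⟨hX, hY⟩ := hRat_coords.mp hP
      rw [WeierstrassCurve.Affine.Point.zCoord_some]; exact Kn.toSubfield.div_mem (Kn.toSubfield.neg_mem hX) hY
  have hlift : ∀ z ∈ Kn.toSubfield, w z < 1 → ∃ P ∈ kernel w (W₀.baseChange (AlgebraicClosure (v.adicCompletion K))), P ∈ Rat ∧ P.zCoord = z := by
    intro z hz hz1
    obtain ⟨P, hPK, hPz⟩ := exists_mem_kernel_zCoord_eq_of_isAlgClosed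
        (V := W₀.baseChange (AlgebraicClosure (v.adicCompletion K))) (w := w) hz1
    refine ⟨P, hPK, (hRat_mem P).mpr fun τ hτ ↦ ?_, hPz⟩
    obtain ⟨hTK, hTz⟩ := hTC_ker τ (hKnC τ hτ) P hPK
    refine eq_of_mem_kernel_of_zCoord_eq hTK hPK ?_
    rw [hTz, hPz]; rw [IntermediateField.mem_fixingSubgroup_iff] at hτ; exact hτ z hz
  have hcomplete : ∀ θ : ℝ≥0, θ < 1 → ∀ a : ℕ → (AlgebraicClosure (v.adicCompletion K)), (∀ r, a r ∈ Kn.toSubfield) → (∀ r, w (a (r + 1) - a r) ≤ θ ^ (r + 1)) → ∃ z ∈ Kn.toSubfield, ∀ r, w (z - a r) ≤ θ ^ (r + 1) := by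
    intro θ hθ a ha hcau
    obtain ⟨y, hy⟩ := exists_limit_of_finiteDimensional hw Kn hθ (fun r ↦ ⟨a r, ha r⟩) hcau; exact ⟨y, y.2, hy⟩
  have hcR : ∀ g, c g ∈ Rat := by
    intro g; rcases hQ : c g with _ | ⟨X, Y, h⟩
    · exact Rat.zero_mem
    · rw [hRat_coords]
      have hXS : X ∈ S₀ := Or.inl ⟨c g, ⟨g, rfl⟩, X, Y, h, hQ, Or.inl rfl⟩
      have hYS : Y ∈ S₀ := Or.inl ⟨c g, ⟨g, rfl⟩, X, Y, h, hQ, Or.inr rfl⟩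
      exact ⟨hM₁Kn (hS₀M₁ hXS), hM₁Kn (hS₀M₁ hYS)⟩
  obtain ⟨θ, hθ1, hρ₀θ⟩ : ∃ θ : ℝ≥0, θ < 1 ∧ ρ₀ = w (∑ q : G ⧸ U, σ ((q.out : G) : (absoluteGaloisGroup (v.adicCompletion K))) x) ^ 2 * θ := by
    have hη2pos : 0 < w (∑ q : G ⧸ U, σ ((q.out : G) : (absoluteGaloisGroup (v.adicCompletion K))) x) ^ 2 := pow_pos hηpos 2
    exact ⟨ρ₀ / _ ^ 2, by rw [div_lt_one hη2pos]; exact hη2, by rw [mul_div_cancel₀ _ hη2pos.ne']⟩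
  have hcz : ∀ g, w (c g).zCoord ≤ w (∑ q : G ⧸ U, σ ((q.out : G) : (absoluteGaloisGroup (v.adicCompletion K))) x) ^ 2 * θ := fun g ↦ hρ₀θ ▸ hcρ₀ g
  -- §H the engine
  obtain ⟨P, hPK, -, hP⟩ := AlmostEtale.exists_forall_eq_sub_of_cocycle_of_trace
    (V := W₀.baseChange (AlgebraicClosure (v.adicCompletion K))) (w := w) (U := U)
    (σ := fun g : G ↦ σ (g : (absoluteGaloisGroup (v.adicCompletion K))))
    (T := fun g : G ↦ T (g : (absoluteGaloisGroup (v.adicCompletion K)))) (S := Kn.toSubfield)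
    (Rat := Rat) (x := x)
    (fun g h z ↦ by rw [Subgroup.coe_mul, hσ, hσ, hσ, mul_smul]) (fun g z ↦ hσw _ z)
    (fun g h Q ↦ by rw [Subgroup.coe_mul]; exact hTmul _ _ Q)
    (fun g Q hQ ↦ (hTC_ker _ (hGC' g) Q hQ).1) (fun g Q hQ ↦ (hTC_ker _ (hGC' g) Q hQ).2)
    (fun g s hs ↦ by rw [hσ]; exact hKnG g s hs) (fun u hu s hs ↦ by rw [hσ]; exact hUKn u hu s hs)
    hRatT (fun u hu Q hQ ↦ hQ _ (hRatU' u hu)) hRatz hlift hcomplete hx1 hxKn hηpos hθ1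
    hcoc hcK hcR hcU hcz
  -- §I conclusion: `φ = ∂(a + Φ⁻¹ P)`
  have hbK : Φ (Φ.symm P) ∈ kernel w (W₀.baseChange (AlgebraicClosure (v.adicCompletion K))) := by rw [AddEquiv.apply_symm_apply]; exact hPK
  refine ⟨a + Φ.symm P, ?_, fun g ↦ ?_⟩
  · rw [← hker, map_add]
    exact AddSubgroup.add_mem (kernel w _) (x := Φ a) (y := Φ (Φ.symm P)) haK' hbK
  · have h1 : φ'.1 g = g • Φ.symm P - Φ.symm P := by
      apply Φ.injective; rw [map_sub, ← hc_apply, hP g, hT, AddEquiv.apply_symm_apply]; rfl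
    have h2 : φ.1 g = φ'.1 g + ((g : absoluteGaloisGroup (v.adicCompletion K)) • a - a) := by rw [hφ'_apply, sub_add_cancel]
    rw [h2, h1, smul_add]
    change (g : absoluteGaloisGroup (v.adicCompletion K)) • Φ.symm P - Φ.symm P + ((g : absoluteGaloisGroup (v.adicCompletion K)) • a - a) = (g : absoluteGaloisGroup (v.adicCompletion K)) • a + (g : absoluteGaloisGroup (v.adicCompletion K)) • Φ.symm P - (a + Φ.symm P)
    abel

end Main

end Summit.BirchSwinnertonDyer.BirchSwinnertonDyer.Theorems.GoodModelKernelH1OfSubquotient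

end
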